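import Summits.Ventures.LatticeQCDFlow.Scoring.TorusParsevalAlternant
import Summits.Ventures.LatticeQCDFlow.Scoring.TorusParsevalPairing
import Summits.Ventures.LatticeQCDFlow.Scoring.UNFluxSectors
import Summits.Ventures.LatticeQCDFlow.Scoring.UNTraceMomentsCentralPhase
import Summits.Ventures.LatticeQCDFlow.Scoring.OneColumnTableaux
import HarnessLib

/-!
# The baryon vertex of `SU(N)`: `∫_{SU(N)} (tr V)^N dV = 1`, the `N`-ality selection rule, and `∫_{U(N)} conj(det U) (tr U)^N dU = 1`

HONEST FRAMING: exact (Metropolis-corrected) sampling algorithms for lattice gauge theory;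
figures of merit are autocorrelation/cost numbers at stated couplings and volumes; no
continuum-physics claim.

Venture `LatticeQCDFlow` (cell pub-lqcd), sub-topic `Scoring`; FANOUT row 5 (`s0-sun-a`), GEN-23.
NEW WORK of the cell (placement rule).  Where the `SU(N)` one-plaquette law first differs from the `U(N)` one:
the `U(1)` centre of `U(N)` kills every unbalanced trace moment (`UNTraceMomentsCentralPhase`), whereas the centre
`ℤ_N` of `SU(N)` only kills those of non-zero `N`-ality, and the first survivor is the BARYON VERTEX
`∫_{SU(N)} (tr V)^N dV = 1` (one invariant in `V^{⊗N}`, the determinant).  Proved here for every `N`, again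
without representation theory beyond the tree's Frobenius formula at the identity:

* §1 **`∫_{U(N)} conj(det U) · (tr U)^N dU = 1`** (`integral_haar_unitaryGroup_conj_det_mul_trace_pow`): Weyl's
  formula for complex class functions (`TorusParsevalPairing` §0), the angle integrand
  `conj(Π e^{iθ_b}) (Σ e^{iθ_b})^N |Δ|² = (a_ρ p_1^N)(e^{iθ}) · conj a_{ρ+1}(e^{iθ})`, the Parseval pairing, and the
  coefficient pairing `Σ_d [x^d](a_ρ p_1^N) [x^d] a_{ρ+1} = N! · f^{(1,…,1)} = N!` (`OneColumnTableaux` §3);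
* §2 **`∫_{SU(N)} (tr V)^N dV = 1`** (`integral_haar_specialUnitaryGroup_trace_pow_card`): the special part
  `u ↦ ζ(u)⁻¹ u` pushes Haar to Haar (the tree's `map_specialPart_haarProbability`) and `ζ(u)^N = det u`;
* §3 THE `N`-ALITY SELECTION RULE **`∫_{SU(N)} (tr V)^j (conj tr V)^l dV = 0` unless `N ∣ j − l`**
  (`integral_haar_specialUnitaryGroup_trace_pow_mul_conj_trace_pow_eq_zero`; the central phase `e^{2πi/N}·1`), so
  `∫_{SU(N)} (tr V)^k dV = 0` for `0 < k < N`; and the moments of `Re tr V` below order `N` reduce to the `|tr V|`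
  moments exactly as for `U(N)` (`integral_re_trace_pow_specialUnitary_of_lt`), while at order `N` the baryon
  vertex adds `2 · 2^{−N}`: **`∫_{SU(N)} (Re tr V)^N dV = 2^{−N} (2 + Σ_{2i=N} C(N,i) ∫_{SU(N)} |tr V|^N dV)`**.

No `def`, no named fact, 0 sorry.
-/

noncomputable section

open Real MeasureTheory Finset Complex Equiv
open scoped ENNReal ComplexConjugate
open Literature.MathematicalPhysics.QuantumFieldTheory (haarProbability)
open Literature.RepresentationTheory.CompactGroups.WeylIntegration
open Literature.RingTheory.SymmetricFunctions.SymmPoly (alternant rho)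

namespace Summit.Ventures.LatticeQCDFlow.Scoring

variable {N : ℕ}

/-! ### 1. `∫_{U(N)} conj(det U) (tr U)^N dU = 1` -/

/-- **`∫_{U(N)} conj(det U) · (tr U)^N dU = 1`** — the one copy of the determinant in the `N`-th tensor power of the
defining representation, computed on the Weyl torus: the angle integrand is `(a_ρ p_1^N)(e^{iθ}) conj a_{ρ+1}(e^{iθ})`
and the coefficient pairing of `a_ρ p_1^N` with the column alternant `a_{ρ+1}` is `N!`. -/
theorem integral_haar_unitaryGroup_conj_det_mul_trace_pow (N : ℕ) :
    ∫ u, conj (((u : Matrix.unitaryGroup (Fin N) ℂ) : Matrix (Fin N) (Fin N) ℂ).det) *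
        ((u : Matrix.unitaryGroup (Fin N) ℂ) : Matrix (Fin N) (Fin N) ℂ).trace ^ N
        ∂(haarProbability (Matrix.unitaryGroup (Fin N) ℂ)) = 1 := by
  have hc : Continuous fun u : Matrix.unitaryGroup (Fin N) ℂ =>
      conj (((u : Matrix.unitaryGroup (Fin N) ℂ) : Matrix (Fin N) (Fin N) ℂ).det) *
        ((u : Matrix.unitaryGroup (Fin N) ℂ) : Matrix (Fin N) (Fin N) ℂ).trace ^ N :=
    (Complex.continuous_conj.comp ((Continuous.matrix_det continuous_id).comp continuous_subtype_val)).mul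
      ((continuous_id.matrix_trace.comp continuous_subtype_val).pow _)
  have hcl : ∀ a u : Matrix.unitaryGroup (Fin N) ℂ,
      conj ((((a * u * a⁻¹ : Matrix.unitaryGroup (Fin N) ℂ)) : Matrix (Fin N) (Fin N) ℂ).det) *
        (((a * u * a⁻¹ : Matrix.unitaryGroup (Fin N) ℂ)) : Matrix (Fin N) (Fin N) ℂ).trace ^ N
      = conj (((u : Matrix.unitaryGroup (Fin N) ℂ) : Matrix (Fin N) (Fin N) ℂ).det) *
        ((u : Matrix.unitaryGroup (Fin N) ℂ) : Matrix (Fin N) (Fin N) ℂ).trace ^ N := by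
    intro a u
    rw [det_conj_unitaryGroup, trace_conj_unitaryGroup]
  rw [integral_unitaryGroup_eq_integral_cube_complex hc hcl]
  -- the angle integrand
  have hθ : ∀ θ : Fin N → ℝ,
      conj ((((torusPt θ : Literature.LinearAlgebra.Matrix.diagonalTorus (Fin N)) : Matrix.unitaryGroup (Fin N) ℂ) :
          Matrix (Fin N) (Fin N) ℂ).det) *
        ((((torusPt θ : Literature.LinearAlgebra.Matrix.diagonalTorus (Fin N)) : Matrix.unitaryGroup (Fin N) ℂ) :
          Matrix (Fin N) (Fin N) ℂ).trace) ^ N *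
        ((∏ p : OD (Fin N), ‖cexp (θ p.1.1 * I) - cexp (θ p.1.2 * I)‖ ^ 2 : ℝ) : ℂ)
      = MvPolynomial.eval₂ (Int.castRingHom ℂ) (fun b => cexp (θ b * I))
          (alternant (fun i => (MvPolynomial.X i : MvPolynomial (Fin N) ℤ)) (rho N) * MvPolynomial.psum (Fin N) ℤ 1 ^ N) *
        conj (MvPolynomial.eval₂ (Int.castRingHom ℂ) (fun b => cexp (θ b * I))
          (alternant (fun i => (MvPolynomial.X i : MvPolynomial (Fin N) ℤ)) fun j => rho N j + 1)) := by
    intro θ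
    rw [eval₂_alternant_mul_psum_pow_mul_conj, coe_torusPt, Matrix.det_diagonal, Matrix.trace_diagonal,
      prod_OD_norm_sub_sq_eq_norm_vdm_sq, ← norm_alternant_rho_eq_norm_vdm]
  simp_rw [hθ]
  rw [integral_cube_eval₂_mul_conj_eval₂]
  have hpair := sum_coeff_mul_coeff_alternant_rho_add_one N
  have hpairC : ∑ d ∈ (alternant (fun i => (MvPolynomial.X i : MvPolynomial (Fin N) ℤ)) (rho N) *
        MvPolynomial.psum (Fin N) ℤ 1 ^ N).support,
      ((MvPolynomial.coeff d (alternant (fun i => (MvPolynomial.X i : MvPolynomial (Fin N) ℤ)) (rho N) *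
          MvPolynomial.psum (Fin N) ℤ 1 ^ N) : ℤ) : ℂ) *
        ((MvPolynomial.coeff d (alternant (fun i => (MvPolynomial.X i : MvPolynomial (Fin N) ℤ)) fun j => rho N j + 1)
          : ℤ) : ℂ) = N.factorial := by
    have h := congrArg (Int.cast : ℤ → ℂ) hpair
    push_cast at h
    exact h
  rw [hpairC]
  push_cast
  have h1 : (2 * (π : ℂ)) ^ N ≠ 0 := pow_ne_zero _ (mul_ne_zero two_ne_zero (Complex.ofReal_ne_zero.mpr Real.pi_ne_zero))
  have h2 : ((N.factorial : ℕ) : ℂ) ≠ 0 := Nat.cast_ne_zero.mpr (Nat.factorial_ne_zero _)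
  field_simp

/-! ### 2. The baryon vertex `∫_{SU(N)} (tr V)^N dV = 1` -/

/-- **THE BARYON VERTEX**: `∫_{SU(N)} (tr V)^N dV = 1` for every `N` (the special part `u ↦ ζ(u)⁻¹ u` pushes the
Haar probability of `U(N)` to that of `SU(N)`, and `(tr(ζ⁻¹u))^N = ζ^{−N} (tr u)^N = conj(det u) (tr u)^N`). -/
theorem integral_haar_specialUnitaryGroup_trace_pow_card (N : ℕ) :
    ∫ V, (((V : Matrix.specialUnitaryGroup (Fin N) ℂ) : Matrix (Fin N) (Fin N) ℂ).trace) ^ N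
        ∂(haarProbability (Matrix.specialUnitaryGroup (Fin N) ℂ)) = 1 := by
  have hc : Continuous fun V : Matrix.specialUnitaryGroup (Fin N) ℂ =>
      (((V : Matrix.specialUnitaryGroup (Fin N) ℂ) : Matrix (Fin N) (Fin N) ℂ).trace) ^ N :=
    (continuous_id.matrix_trace.comp continuous_subtype_val).pow _
  rw [← map_specialPart_haarProbability, integral_map measurable_specialPart.aemeasurable hc.aestronglyMeasurable,
    ← integral_haar_unitaryGroup_conj_det_mul_trace_pow N]
  refine integral_congr_ae (Filter.Eventually.of_forall fun u => ?_)
  have hdet := detPhase_pow (n := Fin N) u.2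
  rw [Fintype.card_fin] at hdet
  have hinv : (detPhase ((u : Matrix.unitaryGroup (Fin N) ℂ) : Matrix (Fin N) (Fin N) ℂ))⁻¹ ^ N
      = conj (((u : Matrix.unitaryGroup (Fin N) ℂ) : Matrix (Fin N) (Fin N) ℂ).det) := by
    rw [inv_pow, hdet, Complex.inv_def, Complex.normSq_eq_norm_sq, norm_det_eq_one u.2, one_pow, inv_one,
      Complex.ofReal_one, mul_one]
  simp only [coe_specialPart, Matrix.trace_smul, smul_eq_mul, mul_pow, hinv]

/-! ### 3. The `N`-ality selection rule and the moments of `Re tr V` on `SU(N)` -/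

/-- The central phase `e^{2πi/N}·1 ∈ SU(N)` (`N ≥ 1`). -/
theorem exp_two_pi_div_smul_one_mem_specialUnitaryGroup (hN : 0 < N) :
    cexp (((2 * π / N : ℝ) : ℂ) * I) • (1 : Matrix (Fin N) (Fin N) ℂ) ∈ Matrix.specialUnitaryGroup (Fin N) ℂ := by
  refine Matrix.mem_specialUnitaryGroup_iff.mpr ⟨exp_mul_I_smul_one_mem_unitaryGroup N _, ?_⟩
  rw [Matrix.det_smul, Matrix.det_one, mul_one, Fintype.card_fin, ← Complex.exp_nat_mul, Complex.exp_eq_one_iff]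
  refine ⟨1, ?_⟩
  have hN' : (N : ℂ) ≠ 0 := Nat.cast_ne_zero.mpr hN.ne'
  push_cast
  field_simp

/-- **THE `N`-ALITY SELECTION RULE**: `∫_{SU(N)} (tr V)^j (conj tr V)^l dV = 0` unless `N ∣ j − l` (left invariance
under the central phase `ω·1`, `ω = e^{2πi/N}`, multiplies the integrand by `ω^{j−l} ≠ 1`). -/
theorem integral_haar_specialUnitaryGroup_trace_pow_mul_conj_trace_pow_eq_zero (hN : 0 < N) {j l : ℕ}
    (hjl : ¬ ((N : ℤ) ∣ (j : ℤ) - (l : ℤ))) :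
    ∫ V, (((V : Matrix.specialUnitaryGroup (Fin N) ℂ) : Matrix (Fin N) (Fin N) ℂ).trace) ^ j *
        conj (((V : Matrix.specialUnitaryGroup (Fin N) ℂ) : Matrix (Fin N) (Fin N) ℂ).trace) ^ l
        ∂(haarProbability (Matrix.specialUnitaryGroup (Fin N) ℂ)) = 0 := by
  set μ := haarProbability (Matrix.specialUnitaryGroup (Fin N) ℂ) with hμ
  set ω : ℂ := cexp (((2 * π / N : ℝ) : ℂ) * I) with hω
  have hω1 : ω ^ j * conj ω ^ l ≠ 1 := by
    intro h
    have hconj : conj ω = cexp (-(((2 * π / N : ℝ) : ℂ) * I)) := by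
      rw [hω, ← Complex.exp_conj, map_mul, Complex.conj_ofReal, Complex.conj_I, mul_neg]
    rw [hconj, hω, ← Complex.exp_nat_mul, ← Complex.exp_nat_mul, ← Complex.exp_add, Complex.exp_eq_one_iff] at h
    obtain ⟨n, hn⟩ := h
    apply hjl
    refine ⟨n, ?_⟩
    have hN' : (N : ℂ) ≠ 0 := Nat.cast_ne_zero.mpr hN.ne'
    have hI : (2 * π * I : ℂ) ≠ 0 :=
      mul_ne_zero (mul_ne_zero two_ne_zero (Complex.ofReal_ne_zero.mpr Real.pi_ne_zero)) I_ne_zero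
    push_cast at hn
    field_simp at hn
    have h'' : (((j : ℤ) - (l : ℤ) : ℤ) : ℂ) = ((N * n : ℤ) : ℂ) := by push_cast; linear_combination hn
    exact_mod_cast h''
  have key := integral_mul_left_eq_self (μ := μ)
    (fun V : Matrix.specialUnitaryGroup (Fin N) ℂ =>
      (((V : Matrix.specialUnitaryGroup (Fin N) ℂ) : Matrix (Fin N) (Fin N) ℂ).trace) ^ j *
        conj (((V : Matrix.specialUnitaryGroup (Fin N) ℂ) : Matrix (Fin N) (Fin N) ℂ).trace) ^ l)
    ⟨ω • 1, exp_two_pi_div_smul_one_mem_specialUnitaryGroup hN⟩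
  have htr : ∀ V : Matrix.specialUnitaryGroup (Fin N) ℂ,
      (((⟨ω • 1, exp_two_pi_div_smul_one_mem_specialUnitaryGroup hN⟩ * V : Matrix.specialUnitaryGroup (Fin N) ℂ)) :
        Matrix (Fin N) (Fin N) ℂ).trace = ω * ((V : Matrix (Fin N) (Fin N) ℂ)).trace := by
    intro V
    show (((ω • (1 : Matrix (Fin N) (Fin N) ℂ)) * (V : Matrix (Fin N) (Fin N) ℂ))).trace = _
    rw [Matrix.smul_mul, one_mul, Matrix.trace_smul, smul_eq_mul]
  simp only [htr, mul_pow, map_mul] at key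
  have hfac : ∀ V : Matrix.specialUnitaryGroup (Fin N) ℂ,
      ω ^ j * ((V : Matrix (Fin N) (Fin N) ℂ)).trace ^ j * (conj ω ^ l * conj (((V : Matrix (Fin N) (Fin N) ℂ)).trace) ^ l)
        = (ω ^ j * conj ω ^ l) * (((V : Matrix (Fin N) (Fin N) ℂ)).trace ^ j *
            conj (((V : Matrix (Fin N) (Fin N) ℂ)).trace) ^ l) := fun V => by ring
  simp_rw [hfac] at key
  rw [integral_const_mul] at key
  have h2 : (ω ^ j * conj ω ^ l - 1) * ∫ V, ((V : Matrix (Fin N) (Fin N) ℂ)).trace ^ j *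
      conj (((V : Matrix (Fin N) (Fin N) ℂ)).trace) ^ l ∂μ = 0 := by rw [sub_mul, one_mul, key, sub_self]
  exact (mul_eq_zero.mp h2).resolve_left (sub_ne_zero.mpr hω1)

/-- `∫_{SU(N)} (tr V)^k dV = 0` for `0 < k < N` (non-zero `N`-ality). -/
theorem integral_haar_specialUnitaryGroup_trace_pow_eq_zero {k : ℕ} (hk : 0 < k) (hkN : k < N) :
    ∫ V, (((V : Matrix.specialUnitaryGroup (Fin N) ℂ) : Matrix (Fin N) (Fin N) ℂ).trace) ^ k
        ∂(haarProbability (Matrix.specialUnitaryGroup (Fin N) ℂ)) = 0 := by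
  have h := integral_haar_specialUnitaryGroup_trace_pow_mul_conj_trace_pow_eq_zero (N := N) (j := k) (l := 0)
    (by omega) (by
      rw [Nat.cast_zero, sub_zero]
      intro hd
      have := Int.le_of_dvd (by exact_mod_cast hk) hd
      omega)
  simpa using h

/-- Integrability of the complex trace monomials on `SU(N)`. -/
theorem integrable_trace_pow_mul_conj_trace_pow_specialUnitary (j l : ℕ) :
    Integrable (fun V : Matrix.specialUnitaryGroup (Fin N) ℂ =>
        (((V : Matrix.specialUnitaryGroup (Fin N) ℂ) : Matrix (Fin N) (Fin N) ℂ).trace) ^ j *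
          conj (((V : Matrix.specialUnitaryGroup (Fin N) ℂ) : Matrix (Fin N) (Fin N) ℂ).trace) ^ l)
      (haarProbability (Matrix.specialUnitaryGroup (Fin N) ℂ)) := by
  have hc : Continuous fun V : Matrix.specialUnitaryGroup (Fin N) ℂ =>
      (((V : Matrix.specialUnitaryGroup (Fin N) ℂ) : Matrix (Fin N) (Fin N) ℂ).trace) ^ j *
        conj (((V : Matrix.specialUnitaryGroup (Fin N) ℂ) : Matrix (Fin N) (Fin N) ℂ).trace) ^ l :=
    ((continuous_id.matrix_trace.comp continuous_subtype_val).pow _).mul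
      ((Complex.continuous_conj.comp (continuous_id.matrix_trace.comp continuous_subtype_val)).pow _)
  obtain ⟨M, hM⟩ : ∃ M, ∀ V, ‖(fun V : Matrix.specialUnitaryGroup (Fin N) ℂ =>
      (((V : Matrix.specialUnitaryGroup (Fin N) ℂ) : Matrix (Fin N) (Fin N) ℂ).trace) ^ j *
        conj (((V : Matrix.specialUnitaryGroup (Fin N) ℂ) : Matrix (Fin N) (Fin N) ℂ).trace) ^ l) V‖ ≤ M := by
    obtain ⟨M, hM⟩ := isCompact_univ.exists_bound_of_continuousOn hc.continuousOn
    exact ⟨M, fun V => hM V (Set.mem_univ V)⟩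
  exact Integrable.mono' (integrable_const M) hc.aestronglyMeasurable (Filter.Eventually.of_forall hM)

/-- `∫_{SU(N)} (conj tr V)^N dV = 1` (the conjugate baryon vertex). -/
theorem integral_haar_specialUnitaryGroup_conj_trace_pow_card (N : ℕ) :
    ∫ V, conj (((V : Matrix.specialUnitaryGroup (Fin N) ℂ) : Matrix (Fin N) (Fin N) ℂ).trace) ^ N
        ∂(haarProbability (Matrix.specialUnitaryGroup (Fin N) ℂ)) = 1 := by
  have h := integral_haar_specialUnitaryGroup_trace_pow_card N
  have h2 : ∫ V, conj ((((V : Matrix.specialUnitaryGroup (Fin N) ℂ) : Matrix (Fin N) (Fin N) ℂ).trace) ^ N)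
      ∂(haarProbability (Matrix.specialUnitaryGroup (Fin N) ℂ)) = conj (1 : ℂ) := by
    rw [← h, integral_conj]
  simpa only [map_pow, map_one] using h2

/-- **THE MOMENTS OF `Re tr V` ON `SU(N)` BELOW ORDER `N` ARE THOSE OF `U(N)`**: for `k < N` only the balanced term
of the binomial expansion of `(tr V + conj tr V)^k` survives the `N`-ality selection rule, so
`∫_{SU(N)} (Re tr V)^k dV = ∫_{U(N)} (Re tr U)^k dU` (both vanish for odd `k`; for `k = 2m` both are
`4^{−m} C(2m,m) ∫ |tr|^{2m}`, equal by `integral_haar_specialUnitaryGroup_norm_trace_pow_eq`). -/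
theorem integral_re_trace_pow_specialUnitary_of_lt {k : ℕ} (hkN : k < N) :
    ∫ V, ((((V : Matrix.specialUnitaryGroup (Fin N) ℂ) : Matrix (Fin N) (Fin N) ℂ).trace).re) ^ k
        ∂(haarProbability (Matrix.specialUnitaryGroup (Fin N) ℂ))
      = ∫ U, (((U : Matrix.unitaryGroup (Fin N) ℂ) : Matrix (Fin N) (Fin N) ℂ).trace.re) ^ k
          ∂(haarProbability (Matrix.unitaryGroup (Fin N) ℂ)) := by
  have hN : 0 < N := by omega
  -- the `SU(N)` side through the binomial expansion
  have hS : ((∫ V, ((((V : Matrix.specialUnitaryGroup (Fin N) ℂ) : Matrix (Fin N) (Fin N) ℂ).trace).re) ^ k ∂(haarProbability (Matrix.specialUnitaryGroup (Fin N) ℂ)) : ℝ) : ℂ)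
      = (2 : ℂ)⁻¹ ^ k * ∑ i ∈ range (k + 1), (∫ V, (((V : Matrix.specialUnitaryGroup (Fin N) ℂ) :
          Matrix (Fin N) (Fin N) ℂ).trace) ^ i * conj (((V : Matrix.specialUnitaryGroup (Fin N) ℂ) :
          Matrix (Fin N) (Fin N) ℂ).trace) ^ (k - i) ∂(haarProbability (Matrix.specialUnitaryGroup (Fin N) ℂ))) * (k.choose i : ℂ) := by
    rw [← integral_complex_ofReal]
    simp_rw [ofReal_re_pow_eq_sum]
    rw [integral_const_mul, integral_finsetSum _ (fun i _ =>
      (integrable_trace_pow_mul_conj_trace_pow_specialUnitary i _).mul_const _)]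
    simp_rw [integral_mul_const]
  have hU : ((∫ U, (((U : Matrix.unitaryGroup (Fin N) ℂ) : Matrix (Fin N) (Fin N) ℂ).trace.re) ^ k
      ∂(haarProbability (Matrix.unitaryGroup (Fin N) ℂ)) : ℝ) : ℂ)
      = (2 : ℂ)⁻¹ ^ k * ∑ i ∈ range (k + 1), (∫ U, (((U : Matrix.unitaryGroup (Fin N) ℂ) :
          Matrix (Fin N) (Fin N) ℂ).trace) ^ i * conj (((U : Matrix.unitaryGroup (Fin N) ℂ) :
          Matrix (Fin N) (Fin N) ℂ).trace) ^ (k - i) ∂(haarProbability (Matrix.unitaryGroup (Fin N) ℂ))) * (k.choose i : ℂ) := by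
    rw [← integral_complex_ofReal]
    simp_rw [ofReal_re_pow_eq_sum]
    rw [integral_const_mul, integral_finsetSum _ (fun i _ =>
      (integrable_trace_pow_mul_conj_trace_pow i _).mul_const _)]
    simp_rw [integral_mul_const]
  -- termwise comparison
  have hterm : ∀ i ∈ range (k + 1), (∫ V, (((V : Matrix.specialUnitaryGroup (Fin N) ℂ) :
        Matrix (Fin N) (Fin N) ℂ).trace) ^ i * conj (((V : Matrix.specialUnitaryGroup (Fin N) ℂ) :
        Matrix (Fin N) (Fin N) ℂ).trace) ^ (k - i) ∂(haarProbability (Matrix.specialUnitaryGroup (Fin N) ℂ)))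
      = ∫ U, (((U : Matrix.unitaryGroup (Fin N) ℂ) : Matrix (Fin N) (Fin N) ℂ).trace) ^ i *
          conj (((U : Matrix.unitaryGroup (Fin N) ℂ) : Matrix (Fin N) (Fin N) ℂ).trace) ^ (k - i)
          ∂(haarProbability (Matrix.unitaryGroup (Fin N) ℂ)) := by
    intro i hi
    rw [mem_range] at hi
    by_cases hik : i = k - i
    · -- the balanced term: `|tr|^{2i}` on both sides
      have hsq : ∀ z : ℂ, z ^ i * conj z ^ (k - i) = ((‖z‖ ^ (2 * i) : ℝ) : ℂ) := by
        intro z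
        rw [← hik, ← mul_pow, Complex.mul_conj, Complex.normSq_eq_norm_sq, pow_mul]
        push_cast; ring
      simp_rw [hsq]
      rw [integral_complex_ofReal, integral_complex_ofReal, integral_haar_specialUnitaryGroup_norm_trace_pow_eq]
    · rw [integral_haar_specialUnitaryGroup_trace_pow_mul_conj_trace_pow_eq_zero hN (fun hd => hik ?_),
        integral_trace_pow_mul_conj_trace_pow_eq_zero (fun h => hik h)]
      -- `N ∣ i − (k − i)` with `|i − (k − i)| ≤ k < N` forces `i = k − i`
      obtain ⟨c, hc⟩ := hd
      have h1 : ((i : ℤ) - ((k - i : ℕ) : ℤ)) < N := by omega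
      have h2 : -(N : ℤ) < ((i : ℤ) - ((k - i : ℕ) : ℤ)) := by omega
      rw [hc] at h1 h2
      have hc0 : c = 0 := by
        rcases lt_trichotomy c 0 with hc' | hc' | hc'
        · nlinarith
        · exact hc'
        · nlinarith
      rw [hc0, mul_zero] at hc
      omega
  have key : ((∫ V, ((((V : Matrix.specialUnitaryGroup (Fin N) ℂ) : Matrix (Fin N) (Fin N) ℂ).trace).re) ^ k
      ∂(haarProbability (Matrix.specialUnitaryGroup (Fin N) ℂ)) : ℝ) : ℂ)
      = ((∫ U, (((U : Matrix.unitaryGroup (Fin N) ℂ) : Matrix (Fin N) (Fin N) ℂ).trace.re) ^ k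
          ∂(haarProbability (Matrix.unitaryGroup (Fin N) ℂ)) : ℝ) : ℂ) := by
    rw [hS, hU]
    congr 1
    exact Finset.sum_congr rfl fun i hi => by rw [hterm i hi]
  exact_mod_cast key

/-- **THE ORDER-`N` MOMENT OF `Re tr V` ON `SU(N)` CARRIES THE BARYON VERTEX**: for `N ≥ 1`,
`∫_{SU(N)} (Re tr V)^N dV = 2^{−N} · (2 + Σ_{i ≤ N, 2i = N} C(N,i) ∫_{SU(N)} |tr V|^N dV)` — the two extreme terms
`i = 0, N` of the binomial expansion are the (conjugate) baryon vertices `= 1`, the middle term (present only for even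
`N`) is the `U(N)`-like balanced one, and all others vanish by `N`-ality.  For `U(N)` the same moment has no `2`. -/
theorem integral_re_trace_pow_card_specialUnitary (hN : 0 < N) :
    ∫ V, ((((V : Matrix.specialUnitaryGroup (Fin N) ℂ) : Matrix (Fin N) (Fin N) ℂ).trace).re) ^ N
        ∂(haarProbability (Matrix.specialUnitaryGroup (Fin N) ℂ))
      = (2 : ℝ)⁻¹ ^ N * (2 + ∑ i ∈ (range (N + 1)).filter (fun i => 2 * i = N), (N.choose i : ℝ) *
          ∫ V, ‖((V : Matrix.specialUnitaryGroup (Fin N) ℂ) : Matrix (Fin N) (Fin N) ℂ).trace‖ ^ (2 * i)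
            ∂(haarProbability (Matrix.specialUnitaryGroup (Fin N) ℂ))) := by
  have hS : ((∫ V, ((((V : Matrix.specialUnitaryGroup (Fin N) ℂ) : Matrix (Fin N) (Fin N) ℂ).trace).re) ^ N
      ∂(haarProbability (Matrix.specialUnitaryGroup (Fin N) ℂ)) : ℝ) : ℂ)
      = (2 : ℂ)⁻¹ ^ N * ∑ i ∈ range (N + 1), (∫ V, (((V : Matrix.specialUnitaryGroup (Fin N) ℂ) :
          Matrix (Fin N) (Fin N) ℂ).trace) ^ i * conj (((V : Matrix.specialUnitaryGroup (Fin N) ℂ) :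
          Matrix (Fin N) (Fin N) ℂ).trace) ^ (N - i) ∂(haarProbability (Matrix.specialUnitaryGroup (Fin N) ℂ))) *
          (N.choose i : ℂ) := by
    rw [← integral_complex_ofReal]
    simp_rw [ofReal_re_pow_eq_sum]
    rw [integral_const_mul, integral_finsetSum _ (fun i _ =>
      (integrable_trace_pow_mul_conj_trace_pow_specialUnitary i _).mul_const _)]
    simp_rw [integral_mul_const]
  -- evaluate each term
  have hterm : ∀ i ∈ range (N + 1), (∫ V, (((V : Matrix.specialUnitaryGroup (Fin N) ℂ) :
        Matrix (Fin N) (Fin N) ℂ).trace) ^ i * conj (((V : Matrix.specialUnitaryGroup (Fin N) ℂ) :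
        Matrix (Fin N) (Fin N) ℂ).trace) ^ (N - i) ∂(haarProbability (Matrix.specialUnitaryGroup (Fin N) ℂ))) * (N.choose i : ℂ)
      = (if i = 0 then 1 else 0) + (if i = N then 1 else 0) +
        (if 2 * i = N then (N.choose i : ℂ) * ((∫ V, ‖((V : Matrix.specialUnitaryGroup (Fin N) ℂ) :
          Matrix (Fin N) (Fin N) ℂ).trace‖ ^ (2 * i) ∂(haarProbability (Matrix.specialUnitaryGroup (Fin N) ℂ)) : ℝ) : ℂ)
         else 0) := by
    intro i hi
    rw [mem_range] at hi
    by_cases h0 : i = 0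
    · subst h0
      rw [if_pos rfl, if_neg (by omega), if_neg (by omega), add_zero, add_zero, Nat.choose_zero_right, Nat.cast_one,
        mul_one, Nat.sub_zero]
      simp_rw [pow_zero, one_mul]
      exact integral_haar_specialUnitaryGroup_conj_trace_pow_card N
    by_cases hN' : i = N
    · subst hN'
      rw [if_neg h0, if_pos rfl, if_neg (by omega), zero_add, add_zero, Nat.choose_self, Nat.cast_one, mul_one,
        Nat.sub_self]
      simp_rw [pow_zero, mul_one]
      exact integral_haar_specialUnitaryGroup_trace_pow_card i
    rw [if_neg h0, if_neg hN', zero_add, zero_add]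
    by_cases hmid : 2 * i = N
    · rw [if_pos hmid]
      have hsq : ∀ z : ℂ, z ^ i * conj z ^ (N - i) = ((‖z‖ ^ (2 * i) : ℝ) : ℂ) := by
        intro z
        rw [show N - i = i by omega, ← mul_pow, Complex.mul_conj, Complex.normSq_eq_norm_sq, pow_mul]
        push_cast; ring
      simp_rw [hsq]
      rw [integral_complex_ofReal, mul_comm]
    · rw [if_neg hmid, integral_haar_specialUnitaryGroup_trace_pow_mul_conj_trace_pow_eq_zero hN (fun hd => hmid ?_),
        zero_mul]
      obtain ⟨c, hc⟩ := hd
      have h1 : ((i : ℤ) - ((N - i : ℕ) : ℤ)) < N := by omega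
      have h2 : -(N : ℤ) < ((i : ℤ) - ((N - i : ℕ) : ℤ)) := by omega
      rw [hc] at h1 h2
      have hc0 : c = 0 := by
        rcases lt_trichotomy c 0 with hc' | hc' | hc'
        · nlinarith
        · exact hc'
        · nlinarith
      rw [hc0, mul_zero] at hc
      omega
  rw [Finset.sum_congr rfl hterm, Finset.sum_add_distrib, Finset.sum_add_distrib, Finset.sum_ite_eq' (range (N + 1)) 0,
    if_pos (mem_range.mpr (by omega)), Finset.sum_ite_eq' (range (N + 1)) N, if_pos (mem_range.mpr (by omega)),
    ← Finset.sum_filter] at hS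
  apply Complex.ofReal_injective
  rw [hS]
  push_cast
  ring

end Summit.Ventures.LatticeQCDFlow.Scoring
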